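import Literature.NumberTheory.EllipticCurves.KenkuMinimalLevelsKleinFricke
import Literature.NumberTheory.EllipticCurves.KleinFrickeLevelFive
import Literature.NumberTheory.EllipticCurves.KleinFrickeLevelSeven
import Mathlib.RingTheory.Polynomial.RationalRoot
import Mathlib.Tactic.ComputeDegree
import HarnessLib

/-!
# Kenku's minimal levels: case (c) at `N' = 5` and `N' = 7`

Third glue file of the `provefact` unit on
`Literature.NumberTheory.EllipticCurves.kenku_minimalLevels_mem_kenkuDegrees` (Silverman, *AEC*
2nd ed., Exercise 6.4; Kenku, J. Number Theory **15** (1982) 199–202, Thm 1), after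
`KenkuMinimalLevels.lean` (cases (a), (b)) and `KenkuMinimalLevelsKleinFricke.lean` (case (c) at
`N' = 2, 3` and the assembly). With the Klein–Fricke theorems at levels `5` and `7` now PROVED
(`KleinFrickeLevelFive.lean`: a rational `5`-isogeny forces `j = (t² + 10t + 5)³/t`;
`KleinFrickeLevelSeven.lean`: a rational `7`-isogeny with `j ≠ 0` forces
`j = (t² + 13t + 49)(t² + 5t + 1)³/t`), Kenku's case (c) at `N' = 5, 7` goes through exactly as
printed (p. 201: "Using the explicit formulae for `j = j(x)` and the `jₘ`, one can easily check
that `Y₀(m·n)(ℚ) = ∅` for the above pairs"): for the fourteen minimal levels `5·m` and `7·m`,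
`m ∈ {11, 17, 19, 37, 43, 67, 163}`, i.e. `55, 85, 95, 185, 215, 335, 815` and
`77, 119, 133, 259, 301, 469, 1141`, a cyclic `N'm`-isogeny would give `j(E) = j_{N'}(t)` AND
`j(E) ∈ Jₘ` (the `j`-table hypothesis `hT`, as in the other files), and no tabulated `j` has that
form — finite checks by the rational-root theorem (`klein_five_integrality`,
`klein_seven_integrality`: `u = den(j)·t` is an integer dividing `125·den(j)⁶`, resp. `49·den(j)⁸`)
and `decide` over the candidates `u = ±5^a·2^c`, resp. `±7^a·2^c` (`kleinFiveCheck_table`,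
`kleinSevenCheck_table`).

The assembly `kenku_minimalLevels_mem_kenkuDegrees_of_schemas₂` is the previous one with these
fourteen levels discharged: the residual list `hRest` is down to the **21** levels
`20, 24, 26, 32, 35, 36, 39, 49, 50, 65, 91, 125, 169` (Kenku (K1): genuine modular-curve input —
Ligozat / Kubert / Mazur–Vélu / Kenku 1979–81 / Mazur–Swinnerton-Dyer), `143, 221, 247, 481, 559,
871, 2119` (case (c) at `N' = 13`: would need Klein–Fricke at level `13`) and `81` (see
`KenkuMinimalLevelsKleinFricke`). No new named fact is introduced (D-0026); `kleinFiveCheck`,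
`kleinSevenCheck` are `Bool` certificate checkers. The level-`7` input is `computational`
(`native_decide` certificates in `KleinFrickeSevenCertificate(B)`), hence so is the assembly.
-/
namespace Literature.NumberTheory.EllipticCurves

open Polynomial WeierstrassCurve

set_option maxHeartbeats 800000 in
/-- **Integrality at level 5.** If `(t² + 10t + 5)³ / t = n / d` with `t ∈ ℚˣ`, `d ≠ 0`, then
`u = d·t` is a nonzero integer dividing `125·d⁶` with `(u² + 10du + 5d²)³ = d⁴·n·u`: `u` is a
rational root of the monic integer polynomial `(X² + 10dX + 5d²)³ - d⁴nX`, so an integer dividing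
its constant term (rational root theorem). [folklore] -/
theorem klein_five_integrality {t : ℚ} (ht : t ≠ 0) {n d : ℤ} (hd : d ≠ 0)
    (h : (t ^ 2 + 10 * t + 5) ^ 3 / t = n / d) :
    ∃ u : ℤ, u ≠ 0 ∧ u ∣ 125 * d ^ 6 ∧ (u ^ 2 + 10 * d * u + 5 * d ^ 2) ^ 3 = d ^ 4 * n * u := by
  have hdQ : (d : ℚ) ≠ 0 := by exact_mod_cast hd
  have hrel : (t ^ 2 + 10 * t + 5) ^ 3 * d = n * t := by
    rw [div_eq_div_iff ht hdQ] at h; linear_combination h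
  set p : ℤ[X] := X ^ 6 + C (30 * d) * X ^ 5 + C (315 * d ^ 2) * X ^ 4 + C (1300 * d ^ 3) * X ^ 3 +
    C (1575 * d ^ 4) * X ^ 2 + C (750 * d ^ 5 - d ^ 4 * n) * X + C (125 * d ^ 6) with hp
  have hmonic : p.Monic := by rw [hp]; monicity!
  have hroot : aeval ((d : ℚ) * t) p = 0 := by
    rw [hp]
    simp only [map_add, map_sub, map_mul, map_pow, aeval_X, map_ofNat, map_intCast, eq_intCast]
    linear_combination (d : ℚ) ^ 5 * hrel
  obtain ⟨u, hu, -⟩ := exists_integer_of_is_root_of_monic hmonic hroot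
  replace hu : (d : ℚ) * t = u := by simpa using hu
  have hu0 : u ≠ 0 := by
    rintro rfl
    simp only [Int.cast_zero, mul_eq_zero] at hu
    rcases hu with h1 | h1
    · exact hdQ h1
    · exact ht h1
  have key : ((u : ℚ) ^ 2 + 10 * d * u + 5 * (d : ℚ) ^ 2) ^ 3 = (d : ℚ) ^ 4 * n * u := by
    rw [← hu]; linear_combination (d : ℚ) ^ 5 * hrel
  have keyZ : (u ^ 2 + 10 * d * u + 5 * d ^ 2) ^ 3 = d ^ 4 * n * u := by exact_mod_cast key
  refine ⟨u, hu0, ?_, keyZ⟩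
  exact ⟨d ^ 4 * n - (u ^ 5 + 30 * d * u ^ 4 + 315 * d ^ 2 * u ^ 3 + 1300 * d ^ 3 * u ^ 2 +
    1575 * d ^ 4 * u + 750 * d ^ 5), by linear_combination keyZ⟩

/-- Decidable certificate for "`(t² + 10t + 5)³/t ≠ j` for all `t ∈ ℚˣ`": by
`klein_five_integrality` a solution gives `u = ±5^a·2^c` (for `j.den` a power of `2`) with
`(u² + 10du + 5d²)³ = d⁴nu`; we check all candidates. [folklore] -/
def kleinFiveCheck (j : ℚ) : Bool :=
  decide (j.den ∣ 2 ^ 21 ∧ ∀ a ∈ Finset.range 4, ∀ c ∈ Finset.range 130,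
    (5 : ℤ) ^ a * 2 ^ c ∣ 125 * (j.den : ℤ) ^ 6 →
      (((5 : ℤ) ^ a * 2 ^ c) ^ 2 + 10 * j.den * ((5 : ℤ) ^ a * 2 ^ c) + 5 * (j.den : ℤ) ^ 2) ^ 3 ≠
          (j.den : ℤ) ^ 4 * j.num * ((5 : ℤ) ^ a * 2 ^ c) ∧
        ((-((5 : ℤ) ^ a * 2 ^ c)) ^ 2 + 10 * j.den * (-((5 : ℤ) ^ a * 2 ^ c)) +
            5 * (j.den : ℤ) ^ 2) ^ 3 ≠ (j.den : ℤ) ^ 4 * j.num * (-((5 : ℤ) ^ a * 2 ^ c)))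

/-- Soundness of `kleinFiveCheck`. [folklore] -/
theorem klein_five_ne_of_check {j : ℚ} (hc : kleinFiveCheck j = true) {t : ℚ} (ht : t ≠ 0) :
    (t ^ 2 + 10 * t + 5) ^ 3 / t ≠ j := by
  intro h
  have hc' := of_decide_eq_true hc
  obtain ⟨hden, hall⟩ := hc'
  have hd : (j.den : ℤ) ≠ 0 := by exact_mod_cast j.den_nz
  rw [← Rat.num_div_den j] at h
  obtain ⟨u, hu0, hudvd, hkey⟩ := klein_five_integrality ht hd h
  -- `u ∣ 125 · den⁶` and `den ∣ 2²¹`, so `|u| = 5^a · 2^c`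
  have hden' : (j.den : ℤ) ^ 6 ∣ 2 ^ 126 := by
    have : (j.den : ℤ) ∣ 2 ^ 21 := by exact_mod_cast hden
    calc (j.den : ℤ) ^ 6 ∣ (2 ^ 21) ^ 6 := pow_dvd_pow_of_dvd this 6
      _ = 2 ^ 126 := by norm_num
  have hu' : u.natAbs ∣ 5 ^ 3 * 2 ^ 126 := by
    have h1 : u ∣ 125 * 2 ^ 126 := hudvd.trans (mul_dvd_mul_left 125 hden')
    have h2 : u.natAbs ∣ (125 * 2 ^ 126 : ℤ).natAbs := Int.natAbs_dvd_natAbs.mpr h1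
    simpa using h2
  obtain ⟨e, he, f, hf, hef⟩ : ∃ e, e ∣ 5 ^ 3 ∧ ∃ f, f ∣ 2 ^ 126 ∧ u.natAbs = e * f :=
    (Nat.dvd_mul.mp hu')
  |>.imp fun e ⟨f, he, hf, h⟩ => ⟨he, f, hf, h.symm⟩
  obtain ⟨a, ha, rfl⟩ := (Nat.dvd_prime_pow (by norm_num : Nat.Prime 5)).mp he
  obtain ⟨c, hc, rfl⟩ := (Nat.dvd_prime_pow Nat.prime_two).mp hf
  have hc130 : c < 130 := by omega
  have ha4 : a < 4 := by omega
  have hspec := hall a (Finset.mem_range.mpr ha4) c (Finset.mem_range.mpr hc130)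
  have habs : (u.natAbs : ℤ) = 5 ^ a * 2 ^ c := by rw [hef]; push_cast; ring
  rcases Int.natAbs_eq u with hu | hu
  · rw [hu, habs] at hkey hudvd
    exact (hspec hudvd).1 hkey
  · rw [hu, habs] at hkey hudvd
    rw [neg_dvd] at hudvd
    exact (hspec hudvd).2 hkey

set_option maxHeartbeats 800000 in
/-- **Integrality at level 7.** If `(t² + 13t + 49)(t² + 5t + 1)³ / t = n / d` with `t ∈ ℚˣ`,
`d ≠ 0`, then `u = d·t` is a nonzero integer dividing `49·d⁸` with
`(u² + 13du + 49d²)(u² + 5du + d²)³ = d⁶·n·u` (rational root theorem for the monic integer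
polynomial `(X² + 13dX + 49d²)(X² + 5dX + d²)³ - d⁶nX`). [folklore] -/
theorem klein_seven_integrality {t : ℚ} (ht : t ≠ 0) {n d : ℤ} (hd : d ≠ 0)
    (h : (t ^ 2 + 13 * t + 49) * (t ^ 2 + 5 * t + 1) ^ 3 / t = n / d) :
    ∃ u : ℤ, u ≠ 0 ∧ u ∣ 49 * d ^ 8 ∧
      (u ^ 2 + 13 * d * u + 49 * d ^ 2) * (u ^ 2 + 5 * d * u + d ^ 2) ^ 3 = d ^ 6 * n * u := by
  have hdQ : (d : ℚ) ≠ 0 := by exact_mod_cast hd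
  have hrel : (t ^ 2 + 13 * t + 49) * (t ^ 2 + 5 * t + 1) ^ 3 * d = n * t := by
    rw [div_eq_div_iff ht hdQ] at h; linear_combination h
  set p : ℤ[X] := X ^ 8 + C (28 * d) * X ^ 7 + C (322 * d ^ 2) * X ^ 6 + C (1904 * d ^ 3) * X ^ 5 +
    C (5915 * d ^ 4) * X ^ 4 + C (8624 * d ^ 5) * X ^ 3 + C (4018 * d ^ 6) * X ^ 2 +
    C (748 * d ^ 7 - d ^ 6 * n) * X + C (49 * d ^ 8) with hp
  have hmonic : p.Monic := by rw [hp]; monicity!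
  have hroot : aeval ((d : ℚ) * t) p = 0 := by
    rw [hp]
    simp only [map_add, map_sub, map_mul, map_pow, aeval_X, map_ofNat, map_intCast, eq_intCast]
    linear_combination (d : ℚ) ^ 7 * hrel
  obtain ⟨u, hu, -⟩ := exists_integer_of_is_root_of_monic hmonic hroot
  replace hu : (d : ℚ) * t = u := by simpa using hu
  have hu0 : u ≠ 0 := by
    rintro rfl
    simp only [Int.cast_zero, mul_eq_zero] at hu
    rcases hu with h1 | h1
    · exact hdQ h1
    · exact ht h1
  have key : ((u : ℚ) ^ 2 + 13 * d * u + 49 * (d : ℚ) ^ 2) * ((u : ℚ) ^ 2 + 5 * d * u + (d : ℚ) ^ 2) ^ 3 =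
      (d : ℚ) ^ 6 * n * u := by
    rw [← hu]; linear_combination (d : ℚ) ^ 7 * hrel
  have keyZ : (u ^ 2 + 13 * d * u + 49 * d ^ 2) * (u ^ 2 + 5 * d * u + d ^ 2) ^ 3 = d ^ 6 * n * u := by
    exact_mod_cast key
  refine ⟨u, hu0, ?_, keyZ⟩
  exact ⟨d ^ 6 * n - (u ^ 7 + 28 * d * u ^ 6 + 322 * d ^ 2 * u ^ 5 + 1904 * d ^ 3 * u ^ 4 +
    5915 * d ^ 4 * u ^ 3 + 8624 * d ^ 5 * u ^ 2 + 4018 * d ^ 6 * u + 748 * d ^ 7),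
    by linear_combination keyZ⟩

/-- Decidable certificate for "`(t² + 13t + 49)(t² + 5t + 1)³/t ≠ j` for all `t ∈ ℚˣ`": by
`klein_seven_integrality` a solution gives `u = ±7^a·2^c` (for `j.den` a power of `2`) with
`(u² + 13du + 49d²)(u² + 5du + d²)³ = d⁶nu`; we check all candidates. [folklore] -/
def kleinSevenCheck (j : ℚ) : Bool :=
  decide (j.den ∣ 2 ^ 21 ∧ ∀ a ∈ Finset.range 3, ∀ c ∈ Finset.range 170,
    (7 : ℤ) ^ a * 2 ^ c ∣ 49 * (j.den : ℤ) ^ 8 →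
      (((7 : ℤ) ^ a * 2 ^ c) ^ 2 + 13 * j.den * ((7 : ℤ) ^ a * 2 ^ c) + 49 * (j.den : ℤ) ^ 2) *
          (((7 : ℤ) ^ a * 2 ^ c) ^ 2 + 5 * j.den * ((7 : ℤ) ^ a * 2 ^ c) + (j.den : ℤ) ^ 2) ^ 3 ≠
          (j.den : ℤ) ^ 6 * j.num * ((7 : ℤ) ^ a * 2 ^ c) ∧
        (((-((7 : ℤ) ^ a * 2 ^ c)) ^ 2 + 13 * j.den * (-((7 : ℤ) ^ a * 2 ^ c)) +
            49 * (j.den : ℤ) ^ 2) *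
          ((-((7 : ℤ) ^ a * 2 ^ c)) ^ 2 + 5 * j.den * (-((7 : ℤ) ^ a * 2 ^ c)) +
            (j.den : ℤ) ^ 2) ^ 3 ≠ (j.den : ℤ) ^ 6 * j.num * (-((7 : ℤ) ^ a * 2 ^ c))))

/-- Soundness of `kleinSevenCheck`. [folklore] -/
theorem klein_seven_ne_of_check {j : ℚ} (hc : kleinSevenCheck j = true) {t : ℚ} (ht : t ≠ 0) :
    (t ^ 2 + 13 * t + 49) * (t ^ 2 + 5 * t + 1) ^ 3 / t ≠ j := by
  intro h
  have hc' := of_decide_eq_true hc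
  obtain ⟨hden, hall⟩ := hc'
  have hd : (j.den : ℤ) ≠ 0 := by exact_mod_cast j.den_nz
  rw [← Rat.num_div_den j] at h
  obtain ⟨u, hu0, hudvd, hkey⟩ := klein_seven_integrality ht hd h
  have hden' : (j.den : ℤ) ^ 8 ∣ 2 ^ 168 := by
    have : (j.den : ℤ) ∣ 2 ^ 21 := by exact_mod_cast hden
    calc (j.den : ℤ) ^ 8 ∣ (2 ^ 21) ^ 8 := pow_dvd_pow_of_dvd this 8
      _ = 2 ^ 168 := by norm_num
  have hu' : u.natAbs ∣ 7 ^ 2 * 2 ^ 168 := by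
    have h1 : u ∣ 49 * 2 ^ 168 := hudvd.trans (mul_dvd_mul_left 49 hden')
    have h2 : u.natAbs ∣ (49 * 2 ^ 168 : ℤ).natAbs := Int.natAbs_dvd_natAbs.mpr h1
    simpa using h2
  obtain ⟨e, he, f, hf, hef⟩ : ∃ e, e ∣ 7 ^ 2 ∧ ∃ f, f ∣ 2 ^ 168 ∧ u.natAbs = e * f :=
    (Nat.dvd_mul.mp hu')
  |>.imp fun e ⟨f, he, hf, h⟩ => ⟨he, f, hf, h.symm⟩
  obtain ⟨a, ha, rfl⟩ := (Nat.dvd_prime_pow (by norm_num : Nat.Prime 7)).mp he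
  obtain ⟨c, hc, rfl⟩ := (Nat.dvd_prime_pow Nat.prime_two).mp hf
  have hc170 : c < 170 := by omega
  have ha3 : a < 3 := by omega
  have hspec := hall a (Finset.mem_range.mpr ha3) c (Finset.mem_range.mpr hc170)
  have habs : (u.natAbs : ℤ) = 7 ^ a * 2 ^ c := by rw [hef]; push_cast; ring
  rcases Int.natAbs_eq u with hu | hu
  · rw [hu, habs] at hkey hudvd
    exact (hspec hudvd).1 hkey
  · rw [hu, habs] at hkey hudvd
    rw [neg_dvd] at hudvd
    exact (hspec hudvd).2 hkey

set_option maxHeartbeats 4000000 in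
/-- The level-`5` finite check over the `j`-invariants of prime level in `kenkuIsogenyJTable`
(the eleven values of `largePrimeIsogenyJTable`): none is of the form `(t² + 10t + 5)³/t`,
`t ∈ ℚˣ` (Kenku 1982, p. 201, pairs `(5, m)`). The composite levels are excluded (and irrelevant:
`70, 75, 105, 135` are not minimal); e.g. `j(50A1) = -25/2` of level `15` IS of that form.
[cite: Kenku1982, proof of Thm. 1, p. 201] -/
theorem kleinFiveCheck_table : ∀ q ∈ kenkuIsogenyJTable,
    q.1 ≠ 14 → q.1 ≠ 15 → q.1 ≠ 21 → q.1 ≠ 27 → kleinFiveCheck q.2 = true := by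
  decide +kernel

/-- A cyclic isogeny of degree divisible by `5` out of `W` forces `j(W) = (t² + 10t + 5)³/t`
(first factor it through its cyclic degree-`5` quotient, `Isogeny.exists_isCyclic_degree_eq_of_dvd`,
then `Isogeny.exists_j_eq_klein_five_of_degree_eq_five`). [cite: SilvermanAEC2009, III.4.11,
III.4.12] -/
theorem _root_.WeierstrassCurve.Isogeny.exists_j_eq_klein_five_of_five_dvd_degree
    {K : Type*} [Field K] [CharZero K] {W W' : WeierstrassCurve K} [W.IsElliptic]
    (φ : Isogeny W W') (hφ : φ.IsCyclic) (h5 : 5 ∣ φ.degree) :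
    ∃ t : K, t ≠ 0 ∧ W.j = (t ^ 2 + 10 * t + 5) ^ 3 / t := by
  obtain ⟨V, hV, ψ, -, hψd, -⟩ := φ.exists_isCyclic_degree_eq_of_dvd hφ (d := 5) h5
  haveI := hV
  exact ψ.exists_j_eq_klein_five_of_degree_eq_five hψd

/-- **No cyclic `ℚ`-isogeny of degree `5m`, `m ∈ {11, 17, 19, 37, 43, 67, 163}`, granted the
`j`-tables** (Kenku 1982, proof of Thm. 1, case (c), `N' = 5`, p. 201): a cyclic `5m`-isogeny gives
`j(E) = (t²+10t+5)³/t` (`exists_j_eq_klein_five_of_five_dvd_degree`, PROVED) and a cyclic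
`m`-isogeny out of `E`, so `j(E) ∈ Jₘ` by `hT`; `kleinFiveCheck_table` excludes every tabulated
value. Levels covered: `55, 85, 95, 185, 215, 335, 815`. [cite: Kenku1982, proof of Thm. 1,
p. 201] -/
theorem isCyclic_degree_ne_five_mul_of_jTable
    (hT : ∀ (V V' : WeierstrassCurve ℚ) [V.IsElliptic] [V'.IsElliptic] (ψ : Isogeny V V'),
      ψ.IsCyclic → ψ.degree ∈ ({11, 14, 15, 17, 19, 21, 27, 37, 43, 67, 163} : Finset ℕ) →
        (ψ.degree, V.j) ∈ kenkuIsogenyJTable)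
    {W W' : WeierstrassCurve ℚ} [W.IsElliptic] (φ : Isogeny W W') (hφ : φ.IsCyclic) {N : ℕ}
    (hN : N ∈ ({11, 17, 19, 37, 43, 67, 163} : Finset ℕ)) :
    φ.degree ≠ 5 * N := fun hdeg ↦ by
  obtain ⟨t, ht, hj⟩ := φ.exists_j_eq_klein_five_of_five_dvd_degree hφ (hdeg ▸ dvd_mul_right 5 N)
  obtain ⟨V₂, hV₂, ψ, hψc, hψd, -⟩ :=
    φ.exists_isCyclic_degree_eq_of_dvd hφ (d := N) (hdeg ▸ dvd_mul_left N 5)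
  haveI := hV₂
  have hB : ∀ n ∈ ({11, 17, 19, 37, 43, 67, 163} : Finset ℕ),
      n ∈ ({11, 14, 15, 17, 19, 21, 27, 37, 43, 67, 163} : Finset ℕ) ∧
        n ≠ 14 ∧ n ≠ 15 ∧ n ≠ 21 ∧ n ≠ 27 := by decide
  have hmem := hT W V₂ ψ hψc (hψd ▸ (hB N hN).1)
  rw [hψd] at hmem
  exact klein_five_ne_of_check (kleinFiveCheck_table _ hmem (hB N hN).2.1 (hB N hN).2.2.1
    (hB N hN).2.2.2.1 (hB N hN).2.2.2.2) ht hj.symm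

set_option maxHeartbeats 4000000 in
/-- The level-`7` finite check over the `j`-invariants of prime level in `kenkuIsogenyJTable`:
none is of the form `(t² + 13t + 49)(t² + 5t + 1)³/t`, `t ∈ ℚˣ` (Kenku 1982, p. 201, pairs
`(7, m)`), and none is `0`. [cite: Kenku1982, proof of Thm. 1, p. 201] -/
theorem kleinSevenCheck_table : ∀ q ∈ kenkuIsogenyJTable,
    q.1 ≠ 14 → q.1 ≠ 15 → q.1 ≠ 21 → q.1 ≠ 27 → kleinSevenCheck q.2 = true ∧ q.2 ≠ 0 := by
  decide +kernel

/-- A cyclic isogeny of degree divisible by `7` out of `W` with `j(W) ≠ 0` forces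
`j(W) = (t² + 13t + 49)(t² + 5t + 1)³/t` (`Isogeny.exists_isCyclic_degree_eq_of_dvd`, then
`Isogeny.exists_j_eq_klein_seven_of_degree_eq_seven`). [cite: SilvermanAEC2009, III.4.11,
III.4.12] -/
theorem _root_.WeierstrassCurve.Isogeny.exists_j_eq_klein_seven_of_seven_dvd_degree
    {K : Type*} [Field K] [CharZero K] {W W' : WeierstrassCurve K} [W.IsElliptic]
    (φ : Isogeny W W') (hφ : φ.IsCyclic) (h7 : 7 ∣ φ.degree) (hj : W.j ≠ 0) :
    ∃ t : K, t ≠ 0 ∧ W.j = (t ^ 2 + 13 * t + 49) * (t ^ 2 + 5 * t + 1) ^ 3 / t := by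
  obtain ⟨V, hV, ψ, -, hψd, -⟩ := φ.exists_isCyclic_degree_eq_of_dvd hφ (d := 7) h7
  haveI := hV
  exact ψ.exists_j_eq_klein_seven_of_degree_eq_seven hψd hj

/-- **No cyclic `ℚ`-isogeny of degree `7m`, `m ∈ {11, 17, 19, 37, 43, 67, 163}`, granted the
`j`-tables** (Kenku 1982, proof of Thm. 1, case (c), `N' = 7`, p. 201): a cyclic `7m`-isogeny
gives a cyclic `m`-isogeny out of `E`, so `j(E) ∈ Jₘ` by `hT` (in particular `j(E) ≠ 0`), and
then `j(E) = (t²+13t+49)(t²+5t+1)³/t` (`exists_j_eq_klein_seven_of_seven_dvd_degree`, PROVED,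
`computational`); `kleinSevenCheck_table` excludes every tabulated value. Levels covered:
`77, 119, 133, 259, 301, 469, 1141`. [cite: Kenku1982, proof of Thm. 1, p. 201] -/
theorem isCyclic_degree_ne_seven_mul_of_jTable
    (hT : ∀ (V V' : WeierstrassCurve ℚ) [V.IsElliptic] [V'.IsElliptic] (ψ : Isogeny V V'),
      ψ.IsCyclic → ψ.degree ∈ ({11, 14, 15, 17, 19, 21, 27, 37, 43, 67, 163} : Finset ℕ) →
        (ψ.degree, V.j) ∈ kenkuIsogenyJTable)
    {W W' : WeierstrassCurve ℚ} [W.IsElliptic] (φ : Isogeny W W') (hφ : φ.IsCyclic) {N : ℕ}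
    (hN : N ∈ ({11, 17, 19, 37, 43, 67, 163} : Finset ℕ)) :
    φ.degree ≠ 7 * N := fun hdeg ↦ by
  obtain ⟨V₂, hV₂, ψ, hψc, hψd, -⟩ :=
    φ.exists_isCyclic_degree_eq_of_dvd hφ (d := N) (hdeg ▸ dvd_mul_left N 7)
  haveI := hV₂
  have hB : ∀ n ∈ ({11, 17, 19, 37, 43, 67, 163} : Finset ℕ),
      n ∈ ({11, 14, 15, 17, 19, 21, 27, 37, 43, 67, 163} : Finset ℕ) ∧
        n ≠ 14 ∧ n ≠ 15 ∧ n ≠ 21 ∧ n ≠ 27 := by decide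
  have hmem := hT W V₂ ψ hψc (hψd ▸ (hB N hN).1)
  rw [hψd] at hmem
  obtain ⟨hcheck, hj0⟩ := kleinSevenCheck_table _ hmem (hB N hN).2.1 (hB N hN).2.2.1
    (hB N hN).2.2.2.1 (hB N hN).2.2.2.2
  obtain ⟨t, ht, hj⟩ :=
    φ.exists_j_eq_klein_seven_of_seven_dvd_degree hφ (hdeg ▸ dvd_mul_right 7 N) hj0
  exact klein_seven_ne_of_check hcheck ht hj.symm

/-- **Kenku's theorem from the schemas, levels `5` and `7` discharged** (Kenku 1982, proof of
Thm. 1): `kenku_minimalLevels_mem_kenkuDegrees_of_schemas` with the fourteen levels `5m`, `7m`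
removed from the residual list, which is now the 21 levels `20, 24, 26, 32, 35, 36, 39, 49, 50,
65, 91, 125, 169` (K1), `143, 221, 247, 481, 559, 871, 2119` (`N' = 13`), `81`. Hypotheses `hU`
(two rational cyclic `N`-subgroups never coexist, `N ∈ B ∖ {27}`) and `hT` (the `j`-tables `J_N`,
`N ∈ B`) are as there. [cite: Kenku1982, Thm. 1 and its proof, pp. 199–201] -/
theorem kenku_minimalLevels_mem_kenkuDegrees_of_schemas₂
    (hU : ∀ N ∈ ({11, 17, 19, 37, 43, 67, 163, 14, 15, 21} : Finset ℕ),
      ∀ (V V₂ V₃ : WeierstrassCurve ℚ) [V.IsElliptic] [V₂.IsElliptic] [V₃.IsElliptic]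
        (ψ₁ : Isogeny V V₂) (ψ₂ : Isogeny V V₃), ψ₁.IsCyclic → ψ₂.IsCyclic →
        ψ₁.degree = N → ψ₂.degree = N → ψ₁.toAddMonoidHom.ker = ψ₂.toAddMonoidHom.ker)
    (hT : ∀ (V V' : WeierstrassCurve ℚ) [V.IsElliptic] [V'.IsElliptic] (ψ : Isogeny V V'),
      ψ.IsCyclic → ψ.degree ∈ ({11, 14, 15, 17, 19, 21, 27, 37, 43, 67, 163} : Finset ℕ) →
        (ψ.degree, V.j) ∈ kenkuIsogenyJTable)
    (hRest : ∀ (V V' : WeierstrassCurve ℚ) [V.IsElliptic] [V'.IsElliptic] (ψ : Isogeny V V'),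
      ψ.IsCyclic → ψ.degree ∉ ({20, 24, 26, 32, 35, 36, 39, 49, 50, 65, 91, 125, 169, 143, 221,
        247, 481, 559, 871, 2119, 81} : Finset ℕ)) :
    kenku_minimalLevels_mem_kenkuDegrees := by
  refine kenku_minimalLevels_mem_kenkuDegrees_of_schemas hU hT fun V V' _ _ ψ hψ hmem ↦ ?_
  have hsplit : ∀ n ∈ ({20, 24, 26, 32, 35, 36, 39, 49, 50, 65, 91, 125, 169, 55, 85, 95, 185,
      215, 335, 815, 77, 119, 133, 259, 301, 469, 1141, 143, 221, 247, 481, 559, 871, 2119,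
      81} : Finset ℕ),
      (∃ N ∈ ({11, 17, 19, 37, 43, 67, 163} : Finset ℕ), n = 5 * N) ∨
        (∃ N ∈ ({11, 17, 19, 37, 43, 67, 163} : Finset ℕ), n = 7 * N) ∨
          n ∈ ({20, 24, 26, 32, 35, 36, 39, 49, 50, 65, 91, 125, 169, 143, 221, 247, 481, 559,
            871, 2119, 81} : Finset ℕ) := by
    decide
  rcases hsplit _ hmem with ⟨N, hN, hdeg⟩ | ⟨N, hN, hdeg⟩ | h
  · exact isCyclic_degree_ne_five_mul_of_jTable hT ψ hψ hN hdeg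
  · exact isCyclic_degree_ne_seven_mul_of_jTable hT ψ hψ hN hdeg
  · exact hRest V V' ψ hψ h

end Literature.NumberTheory.EllipticCurves
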